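import Summits.QuantumFields.YangMills.Theorems.BalabanUVNodesN15KingModelTorusReflectionPositivityAllPlanes
import Literature.Probability.LatticeModels.ChessboardEstimateObservables
import HarnessLib

/-!
# BalabanUVNodes ∕ N15 — THE KING-MODEL RUNG (PART Ϗ-f): THE CHESSBOARD ESTIMATE (Fröhlich–Israel–Lieb–Simon Thm 4.1) FOR KING's RG BLOCK FIELDS —
# on every King-model torus `(ℤ∕2L^m)^{d+1}` the block-field law `dμ^{(K)} = N(0, (Δ^{(K)})⁻¹)` satisfies ALL the reflection hypotheses of the tree's observable-form
# chessboard estimate `chessboard_integral_prod_of_reflectionPositive` (reflections through every unit-site boundary in every direction), hence for every coherent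
# localised array of bounded site observables `|⟨Π_c g_{σ(c),c}⟩| ^ ((2L^m)^{d+1}) ≤ Π_c ⟨Π_{c′} g_{σ(c),c′}⟩`
# (Track A, DAG node N15 = NE2; FAN-OUT v1.1 §N15 s3 «KING-MODEL RUNG»; count-neutral)

HONEST FRAMING.  Count-neutral (cell `pub-ymgap`, seat `pub-ymgap-dag-n15-e` g37; `--supports stmt-QuantumFields-27366 --as helper` = K3⁸).  King's `A = 0`, `g = 0` model:
the RG block-field law `N(0, (Δ^{(K_j)})⁻¹)` ([King1986] (2.14) p.653, (4.5) p.670) on the King-model family's unit torus `(ℤ∕2L^m)^{d+1}` (cells = unit sites,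
`BlockIdx (d+1) (2L^m)` of the tree's chessboard files).  Part Ϗ-c proved, in the tree's FILS vocabulary, that this law is reflection positive and reflection
invariant for EVERY `Torus.reflectBetweenSites κ k′` ∕ `Torus.halfBetweenSites κ k′`.  The tree's observable-form chessboard estimate
(`Literature.Probability.LatticeModels.chessboard_integral_prod_of_reflectionPositive`, FILS Thm 4.1 ∕ Friedli–Velenik Thm 10.11 ∕ Biskup Thm 5.8) asks exactly for:
`μ`-preserving involutions `Θ i k`, sub-σ-algebras `𝓕₊ i k` with real reflection positivity `0 ≤ ∫ F·(F∘Θ i k)`, for the cell reflections `cellReflect i k`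
(`c_i ↦ 2k − 1 − c_i`) and halves `halfPlus N i k = {val(c_i − k) < N∕2}`.  HERE: `Θ i k := configReflect (reflectBetweenSites i (k − 1))` — which IS `cellReflect i k`
on sites (★ `cellReflect_eq_torusReflectBetweenSites`) — and `𝓕₊ i k := positiveEvents (halfBetweenSites i (k − 1))` — which IS `halfPlus` (★ `mem_halfPlus_iff_mem_halfBetweenSites`);
★★ `king_blockField_reflectionHypotheses` discharges the four reflection hypotheses (`MeasurePreserving`, involution, `≤ pi`, real RP) BY NAME from part Ϗ-c, and
★★★ **`king_blockField_chessboard`** ∕ ★★★ `king_blockField_chessboard_rpow` ∕ ★★ `king_blockField_chessboard_subset` are the tree's three chessboard conclusions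
for `μ = N(0,(Δ^{(K_j)})⁻¹)`, for EVERY coherent localised array `g` (user hypotheses `hgb`, `hgP`, `hgΘ` verbatim in the tree's vocabulary).  NOT an infrared bound ∕
phase transition statement; NOT Bałaban's objects; NOT a node discharge; nothing continuum ∕ `ℝ⁴` ∕ OS axioms ∕ mass gap ∕ Clay.  0 `sorry`, 0 `def`.

WHAT THIS FILE PROVES (kernel).  §1 ★ `cellReflect_eq_torusReflectBetweenSites`, ★ `mem_halfPlus_iff_mem_halfBetweenSites`; §2 `king_blockField_measurePreserving`,
`king_blockField_rpReal`, ★★ `king_blockField_reflectionHypotheses`; §3 ★★★ **`king_blockField_chessboard`**, ★★★ `king_blockField_chessboard_rpow`, ★★ `king_blockField_chessboard_subset`;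
§4 ★★ `fineBlockLaw_isReflectionPositive_betweenSites`, `fineBlockLaw_isReflectionInvariant_betweenSites`, ★★ `king_fineBlockLaw_chessboard_rpow` (the same for `N(0, S₂^{(K_j)})`).

Locators (use): [King1986] (2.14) p.653, (4.5) p.670, (4.41) p.675; FILS 1978 Thm 4.1, Thm 4.3; Friedli–Velenik 2017 Thm 10.11; Biskup 2009 Thm 5.8.
-/

noncomputable section

open scoped BigOperators
open Finset Matrix MeasureTheory

namespace Summit.QuantumFields.YangMills.BalabanUVNodes.N15KingModelRung.TorusRP

open Literature.MathematicalPhysics.QuantumFieldTheory (IsPosSemidefKernel gaussianFieldOfKernel isProbabilityMeasure_gaussianFieldOfKernel)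
open Literature.MathematicalPhysics.QuantumFieldTheory.Balaban1983to89.B5Prop11Plancherel (Tor)
open Literature.Probability.LatticeModels (IsReflectionPositive IsReflectionPositiveReal IsReflectionInvariant positiveEvents configReflect configReflect_apply
  measurable_configReflect configReflect_configReflect_of_involutive isPosSemidefKernel_inv_of_posDef chessboard_integral_prod_of_reflectionPositive
  chessboard_integral_prod_le_prod_rpow chessboard_integral_prod_subset_le)
open Literature.Probability.LatticeModels.Torus (reflectBetweenSites halfBetweenSites reflectBetweenSites_apply reflectBetweenSites_involutive)
open Literature.Barriers.CriticalPhenomena.NonGibbs (BlockIdx cellReflect halfPlus)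

variable {d : ℕ}

/-! ## §1 The chessboard files' cell reflections ∕ halves ARE the FILS reflections between sites ∕ halves (index shift `k ↦ k − 1`) -/

section Dictionary

variable {n : ℕ} [NeZero n] (i : Fin (d + 1)) (k : ZMod n)

omit [NeZero n] in
/-- ★ `cellReflect i k c = reflectBetweenSites i (k − 1) c` (`c_i ↦ 2k − 1 − c_i = 2(k−1) + 1 − c_i`; the same identity as the quantum-lattice file's
`Literature.MathematicalPhysics.QuantumLattice.cellReflect_eq_reflectBetweenSites`, restated here to keep the import cone classical). [cite: FrohlichIsraelLiebSimon1978, Thm 4.3] [cite: FriedliVelenik2017, §10.2] -/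
theorem cellReflect_eq_torusReflectBetweenSites (c : BlockIdx (d + 1) n) :
    cellReflect i k c = reflectBetweenSites (d := d + 1) (L := n) i (k - 1) c := by
  rw [reflectBetweenSites_apply]
  show Function.update c i (2 * k - 1 - c i) = Function.update c i (2 * (k - 1) + 1 - c i)
  congr 1
  ring

/-- ★ `c ∈ halfPlus n i k ↔ c ∈ halfBetweenSites i (k − 1)` (`n` even). [cite: FrohlichIsraelLiebSimon1978, Thm 4.3] [cite: Biskup2009, §5.1 Def. 5.2] -/
theorem mem_halfPlus_iff_mem_halfBetweenSites (hn : Even n) (c : BlockIdx (d + 1) n) :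
    c ∈ halfPlus n i k ↔ c ∈ halfBetweenSites (d := d + 1) (L := n) i (k - 1) := by
  have h := mem_shiftedHalf_iff_mem_halfBetweenSites (d := d) (n := n) i hn (Pi.single i k) c
  simp only [Set.mem_setOf_eq, Pi.sub_apply, Pi.single_eq_same] at h
  rw [← h]
  simp only [halfPlus, Finset.mem_filter, Finset.mem_univ, true_and]

end Dictionary

/-! ## §2 King's block-field law satisfies the reflection hypotheses of the chessboard estimate -/

section Hypotheses

variable (L : ℕ) [NeZero L] (i : Fin (d + 1))

/-- `configReflect (reflectBetweenSites i k′)` preserves King's block-field law (part Ϗ-c's reflection invariance). [cite: King1986, (2.14) p.653] [cite: FrohlichIsraelLiebSimon1978, §2] -/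
theorem king_blockField_measurePreserving (hL : 2 ≤ L) {a m2 : ℝ} (ha : 0 < a) (hm : 0 < m2) (j : KingVolIndex d) (k' : ZMod (2 * L ^ j.m)) :
    haveI : ∀ μ : Fin (d + 1), NeZero ((fun _ : Fin (d + 1) => 2 * L ^ j.m) μ) := kingVol_neZero L j
    MeasurePreserving (configReflect (S := ℝ) (reflectBetweenSites (d := d + 1) (L := 2 * L ^ j.m) i k'))
      (gaussianFieldOfKernel (blockCov L (L ^ j.K) (fun _ : Fin (d + 1) => 2 * L ^ j.m) a m2 j.K))
      (gaussianFieldOfKernel (blockCov L (L ^ j.K) (fun _ : Fin (d + 1) => 2 * L ^ j.m) a m2 j.K)) :=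
  ⟨measurable_configReflect _, blockFieldLaw_isReflectionInvariant_betweenSites i L hL ha hm j k'⟩

/-- Real reflection positivity in the chessboard files' form `0 ≤ ∫ F·(F∘Θ)` for bounded `positiveEvents (halfBetweenSites i k′)`-measurable `F`.
[cite: King1986, (2.14) p.653] [cite: FrohlichIsraelLiebSimon1978, Thm 2.1] -/
theorem king_blockField_rpReal (hL : 2 ≤ L) {a m2 : ℝ} (ha : 0 < a) (hm : 0 < m2) (j : KingVolIndex d) (k' : ZMod (2 * L ^ j.m))
    (F : (Tor (fun _ : Fin (d + 1) => 2 * L ^ j.m) → ℝ) → ℝ)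
    (hF : Measurable[positiveEvents (S := ℝ) (halfBetweenSites (d := d + 1) (L := 2 * L ^ j.m) i k')] F) (hFb : ∃ C, ∀ ω, |F ω| ≤ C) :
    haveI : ∀ μ : Fin (d + 1), NeZero ((fun _ : Fin (d + 1) => 2 * L ^ j.m) μ) := kingVol_neZero L j
    0 ≤ ∫ ω, F ω * F (configReflect (reflectBetweenSites (d := d + 1) (L := 2 * L ^ j.m) i k') ω)
      ∂(gaussianFieldOfKernel (blockCov L (L ^ j.K) (fun _ : Fin (d + 1) => 2 * L ^ j.m) a m2 j.K)) := by
  haveI hI : ∀ μ : Fin (d + 1), NeZero ((fun _ : Fin (d + 1) => 2 * L ^ j.m) μ) := kingVol_neZero L j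
  obtain ⟨C, hC⟩ := hFb
  have h := (blockFieldLaw_isReflectionPositive_betweenSites i L hL ha hm j k').real F hF ⟨C, fun ω => by rw [Real.norm_eq_abs]; exact hC ω⟩
  refine h.trans_eq (integral_congr_ae (Filter.Eventually.of_forall fun ω => ?_))
  exact mul_comm _ _

/-- ★★ **KING's BLOCK-FIELD LAW SATISFIES THE REFLECTION HYPOTHESES OF THE CHESSBOARD ESTIMATE** (every direction `i`, every boundary `k`): with
`Θ i k := configReflect (reflectBetweenSites i (k−1))` and `𝓕₊ i k := positiveEvents (halfBetweenSites i (k−1))`: measure preserving, involutive, `≤ pi`, real RP.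
[cite: King1986, (2.14) p.653, (4.41) p.675] [cite: FrohlichIsraelLiebSimon1978, Thm 4.3] -/
theorem king_blockField_reflectionHypotheses (hL : 2 ≤ L) {a m2 : ℝ} (ha : 0 < a) (hm : 0 < m2) (j : KingVolIndex d) :
    haveI : ∀ μ : Fin (d + 1), NeZero ((fun _ : Fin (d + 1) => 2 * L ^ j.m) μ) := kingVol_neZero L j
    (∀ (i : Fin (d + 1)) (k : ZMod (2 * L ^ j.m)),
        MeasurePreserving (configReflect (S := ℝ) (reflectBetweenSites (d := d + 1) (L := 2 * L ^ j.m) i (k - 1)))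
          (gaussianFieldOfKernel (blockCov L (L ^ j.K) (fun _ : Fin (d + 1) => 2 * L ^ j.m) a m2 j.K))
          (gaussianFieldOfKernel (blockCov L (L ^ j.K) (fun _ : Fin (d + 1) => 2 * L ^ j.m) a m2 j.K)))
      ∧ (∀ (i : Fin (d + 1)) (k : ZMod (2 * L ^ j.m)) (ω : Tor (fun _ : Fin (d + 1) => 2 * L ^ j.m) → ℝ),
          configReflect (reflectBetweenSites (d := d + 1) (L := 2 * L ^ j.m) i (k - 1))
            (configReflect (reflectBetweenSites (d := d + 1) (L := 2 * L ^ j.m) i (k - 1)) ω) = ω)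
      ∧ (∀ (i : Fin (d + 1)) (k : ZMod (2 * L ^ j.m)),
          positiveEvents (S := ℝ) (halfBetweenSites (d := d + 1) (L := 2 * L ^ j.m) i (k - 1)) ≤ MeasurableSpace.pi) := by
  exact ⟨fun i' k => king_blockField_measurePreserving L i' hL ha hm j (k - 1),
    fun i' k ω => configReflect_configReflect_of_involutive (reflectBetweenSites_involutive i' (k - 1)) ω,
    fun _ _ => cylinderEvents_le_pi⟩

end Hypotheses

/-! ## §3 The chessboard estimate for King's block fields -/

section Chessboard

variable (L : ℕ) [NeZero L]

/-- ★★★ **THE CHESSBOARD ESTIMATE (FILS Thm 4.1) FOR KING's RG BLOCK FIELDS**: on the King-model torus `(ℤ∕2L^m)^{d+1}` (`L ≥ 2`, `a, m² > 0`, index `j`), for the law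
`μ = N(0, (Δ^{(K_j)})⁻¹)` and EVERY family `g a c` of bounded measurable site observables forming a COHERENT REFLECTED ARRAY (`g a (cellReflect i k c) = g a c ∘ Θ_{ik}`,
`Θ_{ik} = configReflect (reflectBetweenSites i (k−1))`) localised in the halves (`g a c` measurable in the block fields of `halfBetweenSites i (k−1)` whenever
`c ∈ halfPlus (2L^m) i k`), and every label assignment `σ`: `|∫ Π_c g (σ c) c dμ| ^ ((2L^m)^{d+1}) ≤ Π_c ∫ Π_{c′} g (σ c) c′ dμ`.
[cite: King1986, (2.14) p.653, (4.41) p.675] [cite: FrohlichIsraelLiebSimon1978, Thm 4.1, Thm 4.3] [cite: FriedliVelenik2017, Thm 10.11] [cite: Biskup2009, Thm 5.8] -/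
theorem king_blockField_chessboard (hL : 2 ≤ L) {a m2 : ℝ} (ha : 0 < a) (hm : 0 < m2) (j : KingVolIndex d) {ι : Type*}
    (g : ι → BlockIdx (d + 1) (2 * L ^ j.m) → (Tor (fun _ : Fin (d + 1) => 2 * L ^ j.m) → ℝ) → ℝ) (hgb : ∀ a' c, ∃ C, ∀ ω, |g a' c ω| ≤ C)
    (hgP : ∀ a' c (i : Fin (d + 1)) (k : ZMod (2 * L ^ j.m)), c ∈ halfPlus (2 * L ^ j.m) i k →
      Measurable[positiveEvents (S := ℝ) (halfBetweenSites (d := d + 1) (L := 2 * L ^ j.m) i (k - 1))] (g a' c))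
    (hgΘ : ∀ a' (i : Fin (d + 1)) (k : ZMod (2 * L ^ j.m)) c ω,
      g a' (cellReflect i k c) ω = g a' c (configReflect (reflectBetweenSites (d := d + 1) (L := 2 * L ^ j.m) i (k - 1)) ω))
    (σ : BlockIdx (d + 1) (2 * L ^ j.m) → ι) :
    haveI : ∀ μ : Fin (d + 1), NeZero ((fun _ : Fin (d + 1) => 2 * L ^ j.m) μ) := kingVol_neZero L j
    |∫ ω, ∏ c, g (σ c) c ω ∂(gaussianFieldOfKernel (blockCov L (L ^ j.K) (fun _ : Fin (d + 1) => 2 * L ^ j.m) a m2 j.K))| ^ ((2 * L ^ j.m) ^ (d + 1))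
      ≤ ∏ c, ∫ ω, ∏ c', g (σ c) c' ω ∂(gaussianFieldOfKernel (blockCov L (L ^ j.K) (fun _ : Fin (d + 1) => 2 * L ^ j.m) a m2 j.K)) := by
  haveI hI : ∀ μ : Fin (d + 1), NeZero ((fun _ : Fin (d + 1) => 2 * L ^ j.m) μ) := kingVol_neZero L j
  have hpsd : IsPosSemidefKernel (blockCov L (L ^ j.K) (fun _ : Fin (d + 1) => 2 * L ^ j.m) a m2 j.K) :=
    isPosSemidefKernel_inv_of_posDef (effLaplacian_posDef _ L hL ha hm j.one_le_K)
  haveI := isProbabilityMeasure_gaussianFieldOfKernel hpsd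
  obtain ⟨h1, h2, h3⟩ := king_blockField_reflectionHypotheses L hL ha hm j
  exact chessboard_integral_prod_of_reflectionPositive _ (Nat.succ_pos d) ⟨L ^ j.m, two_mul _⟩
    (fun i k => configReflect (reflectBetweenSites (d := d + 1) (L := 2 * L ^ j.m) i (k - 1))) h1 h2
    (fun i k => positiveEvents (S := ℝ) (halfBetweenSites (d := d + 1) (L := 2 * L ^ j.m) i (k - 1))) h3
    (fun i k F hF hFb => king_blockField_rpReal L i hL ha hm j (k - 1) F hF hFb) g hgb hgP hgΘ σ

/-- ★★★ **ROOT FORM** (FILS (4.3) ∕ Friedli–Velenik (10.20)): `|∫ Π_c g (σ c) c dμ| ≤ Π_c (∫ Π_{c′} g (σ c) c′ dμ) ^ (1∕(2L^m)^{d+1})`.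
[cite: King1986, (2.14) p.653] [cite: FrohlichIsraelLiebSimon1978, Thm 4.1] [cite: FriedliVelenik2017, Thm 10.11] -/
theorem king_blockField_chessboard_rpow (hL : 2 ≤ L) {a m2 : ℝ} (ha : 0 < a) (hm : 0 < m2) (j : KingVolIndex d) {ι : Type*}
    (g : ι → BlockIdx (d + 1) (2 * L ^ j.m) → (Tor (fun _ : Fin (d + 1) => 2 * L ^ j.m) → ℝ) → ℝ) (hgb : ∀ a' c, ∃ C, ∀ ω, |g a' c ω| ≤ C)
    (hgP : ∀ a' c (i : Fin (d + 1)) (k : ZMod (2 * L ^ j.m)), c ∈ halfPlus (2 * L ^ j.m) i k →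
      Measurable[positiveEvents (S := ℝ) (halfBetweenSites (d := d + 1) (L := 2 * L ^ j.m) i (k - 1))] (g a' c))
    (hgΘ : ∀ a' (i : Fin (d + 1)) (k : ZMod (2 * L ^ j.m)) c ω,
      g a' (cellReflect i k c) ω = g a' c (configReflect (reflectBetweenSites (d := d + 1) (L := 2 * L ^ j.m) i (k - 1)) ω))
    (σ : BlockIdx (d + 1) (2 * L ^ j.m) → ι) :
    haveI : ∀ μ : Fin (d + 1), NeZero ((fun _ : Fin (d + 1) => 2 * L ^ j.m) μ) := kingVol_neZero L j
    |∫ ω, ∏ c, g (σ c) c ω ∂(gaussianFieldOfKernel (blockCov L (L ^ j.K) (fun _ : Fin (d + 1) => 2 * L ^ j.m) a m2 j.K))|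
      ≤ ∏ c, (∫ ω, ∏ c', g (σ c) c' ω ∂(gaussianFieldOfKernel (blockCov L (L ^ j.K) (fun _ : Fin (d + 1) => 2 * L ^ j.m) a m2 j.K)))
          ^ ((1 : ℝ) / ((2 * L ^ j.m : ℕ) : ℝ) ^ (d + 1)) := by
  haveI hI : ∀ μ : Fin (d + 1), NeZero ((fun _ : Fin (d + 1) => 2 * L ^ j.m) μ) := kingVol_neZero L j
  have hpsd : IsPosSemidefKernel (blockCov L (L ^ j.K) (fun _ : Fin (d + 1) => 2 * L ^ j.m) a m2 j.K) :=
    isPosSemidefKernel_inv_of_posDef (effLaplacian_posDef _ L hL ha hm j.one_le_K)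
  haveI := isProbabilityMeasure_gaussianFieldOfKernel hpsd
  obtain ⟨h1, h2, h3⟩ := king_blockField_reflectionHypotheses L hL ha hm j
  exact chessboard_integral_prod_le_prod_rpow _ (Nat.succ_pos d) ⟨L ^ j.m, two_mul _⟩
    (fun i k => configReflect (reflectBetweenSites (d := d + 1) (L := 2 * L ^ j.m) i (k - 1))) h1 h2
    (fun i k => positiveEvents (S := ℝ) (halfBetweenSites (d := d + 1) (L := 2 * L ^ j.m) i (k - 1))) h3
    (fun i k F hF hFb => king_blockField_rpReal L i hL ha hm j (k - 1) F hF hFb) g hgb hgP hgΘ σ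

/-- ★★ **SUBSET FORM** (`n` observables in `n` distinct sites, the other sites carrying `1`): `|∫ Π_{c∈S} g (lab c) c dμ| ≤ Π_{c∈S} (∫ Π_{c′} g (lab c) c′ dμ)^{1∕(2L^m)^{d+1}}`.
[cite: King1986, (2.14) p.653] [cite: FrohlichIsraelLiebSimon1978, Thm 4.1] -/
theorem king_blockField_chessboard_subset (hL : 2 ≤ L) {a m2 : ℝ} (ha : 0 < a) (hm : 0 < m2) (j : KingVolIndex d) {ι : Type*}
    (g : ι → BlockIdx (d + 1) (2 * L ^ j.m) → (Tor (fun _ : Fin (d + 1) => 2 * L ^ j.m) → ℝ) → ℝ) (hgb : ∀ a' c, ∃ C, ∀ ω, |g a' c ω| ≤ C)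
    (hgP : ∀ a' c (i : Fin (d + 1)) (k : ZMod (2 * L ^ j.m)), c ∈ halfPlus (2 * L ^ j.m) i k →
      Measurable[positiveEvents (S := ℝ) (halfBetweenSites (d := d + 1) (L := 2 * L ^ j.m) i (k - 1))] (g a' c))
    (hgΘ : ∀ a' (i : Fin (d + 1)) (k : ZMod (2 * L ^ j.m)) c ω,
      g a' (cellReflect i k c) ω = g a' c (configReflect (reflectBetweenSites (d := d + 1) (L := 2 * L ^ j.m) i (k - 1)) ω))
    (S : Finset (BlockIdx (d + 1) (2 * L ^ j.m))) (lab : BlockIdx (d + 1) (2 * L ^ j.m) → ι) :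
    haveI : ∀ μ : Fin (d + 1), NeZero ((fun _ : Fin (d + 1) => 2 * L ^ j.m) μ) := kingVol_neZero L j
    |∫ ω, ∏ c ∈ S, g (lab c) c ω ∂(gaussianFieldOfKernel (blockCov L (L ^ j.K) (fun _ : Fin (d + 1) => 2 * L ^ j.m) a m2 j.K))|
      ≤ ∏ c ∈ S, (∫ ω, ∏ c', g (lab c) c' ω ∂(gaussianFieldOfKernel (blockCov L (L ^ j.K) (fun _ : Fin (d + 1) => 2 * L ^ j.m) a m2 j.K)))
          ^ ((1 : ℝ) / ((2 * L ^ j.m : ℕ) : ℝ) ^ (d + 1)) := by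
  haveI hI : ∀ μ : Fin (d + 1), NeZero ((fun _ : Fin (d + 1) => 2 * L ^ j.m) μ) := kingVol_neZero L j
  have hpsd : IsPosSemidefKernel (blockCov L (L ^ j.K) (fun _ : Fin (d + 1) => 2 * L ^ j.m) a m2 j.K) :=
    isPosSemidefKernel_inv_of_posDef (effLaplacian_posDef _ L hL ha hm j.one_le_K)
  haveI := isProbabilityMeasure_gaussianFieldOfKernel hpsd
  obtain ⟨h1, h2, h3⟩ := king_blockField_reflectionHypotheses L hL ha hm j
  exact chessboard_integral_prod_subset_le _ (Nat.succ_pos d) ⟨L ^ j.m, two_mul _⟩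
    (fun i k => configReflect (reflectBetweenSites (d := d + 1) (L := 2 * L ^ j.m) i (k - 1))) h1 h2
    (fun i k => positiveEvents (S := ℝ) (halfBetweenSites (d := d + 1) (L := 2 * L ^ j.m) i (k - 1))) h3
    (fun i k F hF hFb => king_blockField_rpReal L i hL ha hm j (k - 1) F hF hFb) g hgb hgP hgΘ S lab

end Chessboard

/-! ## §4 The same for the block-averaged law `N(0, S₂^{(K)})` -/

section BlockAverages

variable (L : ℕ) [NeZero L] (i : Fin (d + 1))

/-- ★★ `N(0, S₂^{(K_j)})` (the law of the block averages of King's fine free field on `(ℤ∕2L^m)^{d+1}`, fine torus `(ℤ∕L^K·2L^m)^{d+1}`) is reflection positive for every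
`reflectBetweenSites i k′` ∕ `halfBetweenSites i k′` (`m² > 0`). [cite: King1986, (2.13) p.653, Thm 2.1 (2.23) p.654] [cite: FrohlichIsraelLiebSimon1978, §2, Thm 2.1] -/
theorem fineBlockLaw_isReflectionPositive_betweenSites {m2 : ℝ} (hm : 0 < m2) (j : KingVolIndex d) (k' : ZMod (2 * L ^ j.m)) :
    haveI : ∀ μ : Fin (d + 1), NeZero ((fun _ : Fin (d + 1) => 2 * L ^ j.m) μ) := kingVol_neZero L j
    IsReflectionPositive (gaussianFieldOfKernel (kingS2 (L ^ j.K) (fun _ : Fin (d + 1) => 2 * L ^ j.m) m2))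
      (reflectBetweenSites (d := d + 1) (L := 2 * L ^ j.m) i k') (halfBetweenSites (d := d + 1) (L := 2 * L ^ j.m) i k') := by
  haveI hI : ∀ μ : Fin (d + 1), NeZero ((fun _ : Fin (d + 1) => 2 * L ^ j.m) μ) := kingVol_neZero L j
  have hev : Even (2 * L ^ j.m) := ⟨L ^ j.m, two_mul _⟩
  set t : Tor (fun _ : Fin (d + 1) => 2 * L ^ j.m) := Pi.single i (k' + 1) with ht
  have htk : t i - 1 = k' := by rw [ht, Pi.single_eq_same, add_sub_cancel_right]
  have e1 := shiftedReflPerm_eq_reflectBetweenSites i t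
  have e2 := shiftedHalf_eq_halfBetweenSites i hev t
  rw [htk] at e1 e2
  rw [← e1, ← e2]
  exact fineBlockLaw_isReflectionPositive_plane (L ^ j.K) (fun _ : Fin (d + 1) => 2 * L ^ j.m) i hev hm t

/-- … and reflection invariant. [cite: King1986, (2.13) p.653] [cite: FrohlichIsraelLiebSimon1978, §2] -/
theorem fineBlockLaw_isReflectionInvariant_betweenSites {m2 : ℝ} (hm : 0 < m2) (j : KingVolIndex d) (k' : ZMod (2 * L ^ j.m)) :
    haveI : ∀ μ : Fin (d + 1), NeZero ((fun _ : Fin (d + 1) => 2 * L ^ j.m) μ) := kingVol_neZero L j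
    IsReflectionInvariant (gaussianFieldOfKernel (kingS2 (L ^ j.K) (fun _ : Fin (d + 1) => 2 * L ^ j.m) m2))
      (reflectBetweenSites (d := d + 1) (L := 2 * L ^ j.m) i k') := by
  haveI hI : ∀ μ : Fin (d + 1), NeZero ((fun _ : Fin (d + 1) => 2 * L ^ j.m) μ) := kingVol_neZero L j
  set t : Tor (fun _ : Fin (d + 1) => 2 * L ^ j.m) := Pi.single i (k' + 1) with ht
  have htk : t i - 1 = k' := by rw [ht, Pi.single_eq_same, add_sub_cancel_right]
  have e1 := shiftedReflPerm_eq_reflectBetweenSites i t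
  rw [htk] at e1
  rw [← e1]
  exact Literature.Probability.LatticeModels.gaussianField_isReflectionInvariant (isPosSemidefKernel_kingS2 (L ^ j.K) _ hm)
    (Function.Involutive.toPerm _ (shiftedRefl_involutive i t))
    (fun b b' => shiftedRefl_invariant i t (fun b b' v => kingS2_transl (L ^ j.K) _ hm b b' v) (fun b b' => kingS2_torRefl (L ^ j.K) _ i m2 b b') b b')

/-- ★★ **THE CHESSBOARD ESTIMATE FOR THE BLOCK-AVERAGED LAW `N(0, S₂^{(K_j)})`** (root form), for every coherent localised array of bounded site observables.
[cite: King1986, (2.13) p.653, Thm 2.1 (2.23) p.654] [cite: FrohlichIsraelLiebSimon1978, Thm 4.1, Thm 4.3] [cite: FriedliVelenik2017, Thm 10.11] -/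
theorem king_fineBlockLaw_chessboard_rpow {m2 : ℝ} (hm : 0 < m2) (j : KingVolIndex d) {ι : Type*}
    (g : ι → BlockIdx (d + 1) (2 * L ^ j.m) → (Tor (fun _ : Fin (d + 1) => 2 * L ^ j.m) → ℝ) → ℝ) (hgb : ∀ a' c, ∃ C, ∀ ω, |g a' c ω| ≤ C)
    (hgP : ∀ a' c (i : Fin (d + 1)) (k : ZMod (2 * L ^ j.m)), c ∈ halfPlus (2 * L ^ j.m) i k →
      Measurable[positiveEvents (S := ℝ) (halfBetweenSites (d := d + 1) (L := 2 * L ^ j.m) i (k - 1))] (g a' c))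
    (hgΘ : ∀ a' (i : Fin (d + 1)) (k : ZMod (2 * L ^ j.m)) c ω,
      g a' (cellReflect i k c) ω = g a' c (configReflect (reflectBetweenSites (d := d + 1) (L := 2 * L ^ j.m) i (k - 1)) ω))
    (σ : BlockIdx (d + 1) (2 * L ^ j.m) → ι) :
    haveI : ∀ μ : Fin (d + 1), NeZero ((fun _ : Fin (d + 1) => 2 * L ^ j.m) μ) := kingVol_neZero L j
    |∫ ω, ∏ c, g (σ c) c ω ∂(gaussianFieldOfKernel (kingS2 (L ^ j.K) (fun _ : Fin (d + 1) => 2 * L ^ j.m) m2))|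
      ≤ ∏ c, (∫ ω, ∏ c', g (σ c) c' ω ∂(gaussianFieldOfKernel (kingS2 (L ^ j.K) (fun _ : Fin (d + 1) => 2 * L ^ j.m) m2)))
          ^ ((1 : ℝ) / ((2 * L ^ j.m : ℕ) : ℝ) ^ (d + 1)) := by
  haveI hI : ∀ μ : Fin (d + 1), NeZero ((fun _ : Fin (d + 1) => 2 * L ^ j.m) μ) := kingVol_neZero L j
  have hpsd := isPosSemidefKernel_kingS2 (L ^ j.K) (fun _ : Fin (d + 1) => 2 * L ^ j.m) hm
  haveI := isProbabilityMeasure_gaussianFieldOfKernel hpsd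
  refine chessboard_integral_prod_le_prod_rpow _ (Nat.succ_pos d) ⟨L ^ j.m, two_mul _⟩
    (fun i k => configReflect (reflectBetweenSites (d := d + 1) (L := 2 * L ^ j.m) i (k - 1)))
    (fun i k => ⟨measurable_configReflect _, fineBlockLaw_isReflectionInvariant_betweenSites L i hm j (k - 1)⟩)
    (fun i k ω => configReflect_configReflect_of_involutive (reflectBetweenSites_involutive i (k - 1)) ω)
    (fun i k => positiveEvents (S := ℝ) (halfBetweenSites (d := d + 1) (L := 2 * L ^ j.m) i (k - 1))) (fun _ _ => cylinderEvents_le_pi)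
    (fun i k F hF hFb => ?_) g hgb hgP hgΘ σ
  obtain ⟨C, hC⟩ := hFb
  have h := (fineBlockLaw_isReflectionPositive_betweenSites L i hm j (k - 1)).real F hF ⟨C, fun ω => by rw [Real.norm_eq_abs]; exact hC ω⟩
  refine h.trans_eq (integral_congr_ae (Filter.Eventually.of_forall fun ω => ?_))
  exact mul_comm _ _

end BlockAverages

end Summit.QuantumFields.YangMills.BalabanUVNodes.N15KingModelRung.TorusRP
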